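import Summits.Ventures.WeilGRH.DualTrigKernelSoundE
import HarnessLib

/-!
# Format D-K soundness, part 8: the soundness theorem and the rung

Cell `rh-explicit`, WEIL TRACK — GRH ARM, route B (weil-grh-3).  The conclusion of the series
`DualTrigKernelTaylor/Digamma/SoundA–E`:

* `DKCert.sound` — if `c.check = true` then for every Dirichlet character `χ` mod `c.q` of parity
  `c.par` taking the claimed values `χ(n) = e^{2πi u/v}` on the window, and every real `τ`,
  `0 ≤ M_{χ,N}(τ) + Σ_k (a_k cos(kωτ) + b_k sin(kωτ))` (`M_{χ,N} = weilFinitePrimeWeightChar χ N`,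
  `ω = log p₀ / D`);
* `DKCert.weilPositivityOnChar_of_check` — hence (LEMMA D-K, `DualTrigRung.lean`) the rung
  `WeilPositivityOnChar χ (log (N+1) / 2)`.

So a kernel evaluation `decide` of `c.check` for concrete data `c` is a complete proof of the rung for
the whole KEY GROUP of characters with the listed parity and window values.  Everything here is
PROVED; no named facts, no `sorry`.
-/

noncomputable section

open Finset Real Complex

namespace Summit.Ventures.WeilGRH

open Literature.Analysis.ValidatedNumerics.NumericsMP
open Literature.NumberTheory.LFunctions
open DualTrigTaylor DigammaVertical

namespace DKCert

variable {c : DKCert}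

/-! ### Helpers -/

/-- `sumVal` is additive over list append. [folklore] -/
theorem sumVal_append (l₁ l₂ : List RTerm) (θ : ℝ) : sumVal (l₁ ++ l₂) θ = sumVal l₁ θ + sumVal l₂ θ := by
  simp [sumVal, List.map_append, List.sum_append]

/-- Elements of `cList` are elements of the real list. [folklore] -/
theorem mem_of_mem_cList : ∀ (ts : List GTerm) (rts : List RTerm), ∀ r ∈ cList ts rts, r ∈ rts
  | [], [] => by simp [cList]
  | [], _ :: _ => by simp [cList]
  | _ :: _, [] => by simp [cList]
  | t :: ts, rt :: rts => by
      intro r hr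
      by_cases h : t.comm = true
      · simp only [cList, h, if_true, List.mem_cons] at hr
        rcases hr with rfl | hr
        · simp
        · exact List.mem_cons_of_mem _ (mem_of_mem_cList ts rts r hr)
      · simp only [cList, h, Bool.false_eq_true, if_false] at hr
        exact List.mem_cons_of_mem _ (mem_of_mem_cList ts rts r hr)

/-- In the even case every real term has vanishing sine coefficient. [folklore] -/
theorem termsR_B_zero (hvals : c.valsOK = true) (heven : c.even = true) : ∀ t ∈ c.termsR, t.B = 0 := by
  have hvals0 := hvals
  unfold valsOK at hvals
  simp only [Bool.and_eq_true, heven, Bool.not_true, Bool.false_or, List.all_eq_true, beq_iff_eq] at hvals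
  obtain ⟨_, hat, hvl⟩ := hvals
  intro t ht
  unfold termsR at ht
  rw [List.mem_append, List.mem_map, List.mem_map] at ht
  rcases ht with ⟨atm, hatm, rfl⟩ | ⟨val, hval, rfl⟩
  · simp [atomR, hat atm hatm]
  · simp only [valR, neg_eq_zero, mul_eq_zero]
    right
    have hdiv := hvl val hval
    have hvpos : 1 ≤ val.v := (valsOK_val hvals0 hval).2.2.2.2.2.1
    obtain ⟨k, hk⟩ : ∃ k : ℤ, 2 * val.u = val.v * k := Int.dvd_of_emod_eq_zero hdiv
    have hv0 : (val.v : ℝ) ≠ 0 := Nat.cast_ne_zero.2 (by omega)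
    have e1 : valZ val = Complex.exp (((2 * π * ((val.u : ℝ) / val.v) : ℝ) : ℂ) * I) := by
      unfold valZ; push_cast; ring_nf
    have e : 2 * π * ((val.u : ℝ) / val.v) = (k : ℝ) * π := by
      have hk' : (2 : ℝ) * val.u = val.v * k := by exact_mod_cast hk
      field_simp
      linarith [hk']
    rw [e1, Complex.exp_ofReal_mul_I_im, e, Real.sin_int_mul_pi]

/-- The full function is even in the even case. [folklore] -/
theorem Pθ_neg (hvals : c.valsOK = true) (heven : c.even = true) (θ : ℝ) : c.Pθ (-θ) = c.Pθ θ := by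
  unfold Pθ
  have h1 := bracket_neg (sigR_mem (c := c)).2 0 (c.rhoR * θ)
  simp only [bracket, Finset.range_zero, Finset.sum_empty, sub_zero] at h1
  rw [show ((c.rhoR * -θ : ℝ) : ℂ) = ((-(c.rhoR * θ) : ℝ) : ℂ) by push_cast; ring, h1,
    sumVal_neg c.termsR (termsR_B_zero hvals heven) θ]

/-! ### The three regimes -/

section regimes

variable (hS : 0 < c.S) (hpi : MI.mem c.S Real.pi c.piI) (hrho : MI.mem c.S c.rhoR c.rhoI)
  (hρ : 0 < c.rhoR) (hC : MI.mem c.S c.constR c.constI) (hR : 1 ≤ c.R)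
  (hF : List.Forall₂ (GRepr c.S c.R) c.terms c.termsR) (hblocks : c.blocksOK = true)
  (hcells : c.cellsOK = true)
include hS hpi hrho hρ hC hR hF hblocks hcells

/-- On a checked cell: the full function is `≥ 0`, the periodic part `≥ loT/S` with `loT ≥ mT` on duty
cells. [folklore] -/
theorem cell_bounds {b : DKBlock} (hb : b ∈ c.blocks) {i : ℕ} (hi : i < b.n) {θ : ℝ}
    (h1 : 2 * π * ((b.j0 + i : ℤ) : ℝ) / b.Mc ≤ θ) (h2 : θ ≤ 2 * π * (((b.j0 + i : ℤ) : ℝ) + 1) / b.Mc) :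
    0 ≤ c.Pθ θ ∧ (periodDuty b (b.j0 + i) = true → (c.mT : ℝ) / c.S ≤ sumVal (cList c.terms c.termsR) θ) := by
  obtain ⟨hbs, _, _⟩ := blocksOK_sound hblocks
  obtain ⟨hMc, hn, hnin, hden, heta, htab⟩ := hbs b hb
  obtain ⟨heta', hnum⟩ := eta_ge hS hpi hMc hden heta
  obtain ⟨lo, loT, hcl, hlo, hduty⟩ := cellsOK_sound hcells hb hi
  have hSr : (0 : ℝ) < c.S := by exact_mod_cast hS
  obtain ⟨hP, hT⟩ := cellLo_sound hS hpi hρ hrho hC hR hMc hden hnin hnum heta' htab hF (b.j0 + i) hcl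
    (θ := θ) (by push_cast at h1 ⊢; linarith) (by push_cast at h2 ⊢; linarith)
  refine ⟨?_, fun hd ↦ ?_⟩
  · have hlo0 : (0 : ℝ) ≤ lo := by exact_mod_cast hlo
    have : (0 : ℝ) ≤ (lo : ℝ) / c.S := div_nonneg hlo0 hSr.le
    unfold Pθ; linarith
  · have : ((c.mT : ℤ) : ℝ) / c.S ≤ (loT : ℝ) / c.S := by
      gcongr; exact_mod_cast hduty hd
    exact this.trans hT

/-- On the covered range the full function is `≥ 0`. [folklore] -/
theorem Pθ_nonneg_of_covered {b0 bl : DKBlock} (h0 : c.blocks.head? = some b0) (hl : c.blocks.getLast? = some bl)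
    {θ : ℝ} (h1 : bStart b0 ≤ θ) (h2 : θ ≤ bEnd bl) : 0 ≤ c.Pθ θ := by
  obtain ⟨hbs, hchain, _⟩ := blocksOK_sound hblocks
  obtain ⟨b, hb, hs, he⟩ := exists_block c.blocks b0 bl h0 hl hchain (fun b hb ↦ (hbs b hb).1) θ h1 h2
  obtain ⟨i, hi, hc1, hc2⟩ := exists_cell (hbs b hb).1 (hbs b hb).2.1 hs he
  exact (cell_bounds hS hpi hrho hρ hC hR hF hblocks hcells hb hi hc1 hc2).1

/-- The periodic part is `≥ mT/S` at every point of `[−π, π]` inside the covered range. [folklore] -/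
theorem T_ge_of_covered {b0 bl : DKBlock} (h0 : c.blocks.head? = some b0) (hl : c.blocks.getLast? = some bl)
    {θ : ℝ} (h1 : bStart b0 ≤ θ) (h2 : θ ≤ bEnd bl) (hπ1 : -π ≤ θ) (hπ2 : θ ≤ π) :
    (c.mT : ℝ) / c.S ≤ sumVal (cList c.terms c.termsR) θ := by
  obtain ⟨hbs, hchain, _⟩ := blocksOK_sound hblocks
  obtain ⟨b, hb, hs, he⟩ := exists_block c.blocks b0 bl h0 hl hchain (fun b hb ↦ (hbs b hb).1) θ h1 h2
  have hMc := (hbs b hb).1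
  have hMcr : (0 : ℝ) < b.Mc := by exact_mod_cast hMc
  obtain ⟨i, hi, hc1, hc2⟩ := exists_cell hMc (hbs b hb).2.1 hs he
  refine (cell_bounds hS hpi hrho hρ hC hR hF hblocks hcells hb hi hc1 hc2).2 ?_
  unfold periodDuty
  simp only [Bool.and_eq_true, decide_eq_true_eq]
  constructor
  · -- 2π j/Mc ≤ θ ≤ π
    have : 2 * π * ((b.j0 + i : ℤ) : ℝ) ≤ π * b.Mc := by
      rw [div_le_iff₀ hMcr] at hc1; nlinarith
    have : 2 * ((b.j0 + i : ℤ) : ℝ) ≤ b.Mc := by nlinarith [Real.pi_pos]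
    exact_mod_cast this
  · have : -π * b.Mc ≤ 2 * π * (((b.j0 + i : ℤ) : ℝ) + 1) := by
      rw [le_div_iff₀ hMcr] at hc2; nlinarith
    have : -(b.Mc : ℝ) ≤ 2 * ((b.j0 + i : ℤ) : ℝ) + 2 := by nlinarith [Real.pi_pos]
    exact_mod_cast this

end regimes

/-! ### The soundness theorem -/

/-- **Soundness of the format-D-K kernel checker.**  If `c.check = true` then for every Dirichlet
character `χ` mod `c.q` with `charParity χ = c.par` taking the claimed window values, the multiplier
inequality `0 ≤ M_{χ,N}(τ) + Σ_k (a_k cos(kωτ) + b_k sin(kωτ))` holds for every real `τ`. [folklore] -/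
theorem sound (hc : c.check = true) (χ : DirichletCharacter ℂ c.q) (hpar : charParity χ = c.par)
    (hχ : ∀ val ∈ c.vals, χ (val.n : ZMod c.q) = valZ val) (τ : ℝ) :
    0 ≤ weilFinitePrimeWeightChar χ c.N τ + trigSum (c.atoms.map c.atomT) τ := by
  -- unpack the check
  unfold check frameOK at hc
  simp only [Bool.and_eq_true] at hc
  obtain ⟨⟨⟨⟨⟨⟨hconsts, hvals⟩, hnodup⟩, hblocks⟩, hatoms⟩, htail⟩, hcells⟩ := hc
  obtain ⟨hS, hp0, hD, _, hR, _, hpi, hlog, hrho, hC⟩ := constsOK_sound hconsts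
  obtain ⟨hρ, hρω⟩ := rhoR_pos_and_mul hp0 hD
  have hF := terms_repr hS hpi hlog hp0 hvals
  have hSr : (0 : ℝ) < c.S := by exact_mod_cast hS
  obtain ⟨hbs, hchain, b0, bl, h0, hl, hfirst, hlast⟩ := blocksOK_sound hblocks
  have hb0 : b0 ∈ c.blocks := List.mem_of_mem_head? h0
  have hbl : bl ∈ c.blocks := List.mem_of_mem_getLast? hl
  have hMc0 : (0 : ℝ) < b0.Mc := by exact_mod_cast (hbs b0 hb0).1
  have hMcl : (0 : ℝ) < bl.Mc := by exact_mod_cast (hbs bl hbl).1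
  have hend : π ≤ bEnd bl := by
    unfold bEnd; rw [le_div_iff₀ hMcl]
    have : (bl.Mc : ℝ) ≤ 2 * ((bl.j0 : ℝ) + bl.n) := by exact_mod_cast hlast
    nlinarith [Real.pi_pos]
  have hstart0 : bStart b0 ≤ 0 := by
    unfold bStart
    have : (b0.j0 : ℝ) ≤ 0 := by
      split_ifs at hfirst with he
      · exact_mod_cast hfirst
      · have : (2 * b0.j0 : ℝ) ≤ -(b0.Mc : ℝ) := by exact_mod_cast hfirst
        linarith
    have : 2 * π * (b0.j0 : ℝ) ≤ 0 := by nlinarith [Real.pi_pos]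
    exact div_nonpos_of_nonpos_of_nonneg this hMc0.le
  -- (1) the periodic part everywhere
  have hint : ∀ rt ∈ cList c.terms c.termsR, ∃ k : ℤ, rt.κ = k :=
    cList_int c.terms c.termsR hF isInt_of_comm
  have hT : ∀ θ : ℝ, (c.mT : ℝ) / c.S ≤ sumVal (cList c.terms c.termsR) θ := by
    intro θ
    -- reduce to [−π, π)
    set k : ℤ := ⌊(θ + π) / (2 * π)⌋ with hk
    set θ' : ℝ := θ - k * (2 * π) with hθ'
    have h2π : (0 : ℝ) < 2 * π := by positivity
    have hθ'1 : -π ≤ θ' := by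
      have := Int.floor_le ((θ + π) / (2 * π))
      rw [← hk, le_div_iff₀ h2π] at this; rw [hθ']; linarith
    have hθ'2 : θ' ≤ π := by
      have := Int.lt_floor_add_one ((θ + π) / (2 * π))
      rw [← hk, div_lt_iff₀ h2π] at this; rw [hθ']; linarith
    have hper : sumVal (cList c.terms c.termsR) θ = sumVal (cList c.terms c.termsR) θ' := by
      rw [hθ', show θ - k * (2 * π) = θ + (-k : ℤ) * (2 * π) by push_cast; ring]
      exact (sumVal_add_int_mul _ hint θ (-k)).symm
    rw [hper]
    by_cases he : c.even = true
    · -- fold to [0, π]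
      have hevenB : ∀ t ∈ cList c.terms c.termsR, t.B = 0 :=
        fun t ht ↦ termsR_B_zero hvals he t (mem_of_mem_cList _ _ t ht)
      rcases le_total 0 θ' with hpos | hneg
      · exact T_ge_of_covered hS hpi hrho hρ hC hR hF hblocks hcells h0 hl (hstart0.trans hpos)
          (hθ'2.trans hend) hθ'1 hθ'2
      · rw [← sumVal_neg _ hevenB θ']
        exact T_ge_of_covered hS hpi hrho hρ hC hR hF hblocks hcells h0 hl (by linarith) (by linarith)
          (by linarith) (by linarith)
    · have hstartπ : bStart b0 ≤ -π := by
        rw [Bool.not_eq_true] at he; simp only [he] at hfirst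
        unfold bStart; rw [div_le_iff₀ hMc0]
        have : (2 * b0.j0 : ℝ) ≤ -(b0.Mc : ℝ) := by exact_mod_cast hfirst
        nlinarith [Real.pi_pos]
      exact T_ge_of_covered hS hpi hrho hρ hC hR hF hblocks hcells h0 hl (hstartπ.trans hθ'1)
        (hθ'2.trans hend) hθ'1 hθ'2
  -- (2) the tail
  have hnc : ∀ θ : ℝ, -(((c.bInc : ℤ) : ℝ) / c.S) ≤ sumVal (ncList c.terms c.termsR) θ := by
    intro θ
    have h1 := neg_sum_abs_le_sumVal (ncList c.terms c.termsR) θ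
    have h2 := ncList_abs_le hS c.terms c.termsR hF
    unfold bInc
    linarith
  unfold tailOK at htail
  simp only [h0, hl, Bool.and_eq_true, Bool.or_eq_true] at htail
  obtain ⟨htl, htf⟩ := htail
  have tail_of : ∀ (Mc : ℕ) (jj : ℤ), 1 ≤ Mc →
      (match c.psiTailLo Mc jj with | some v => decide (0 ≤ v + c.constI.lo - c.bInc + c.mT) | none => false) = true →
      ∀ θ : ℝ, 2 * π * |(jj : ℝ)| / Mc ≤ |θ| → 0 ≤ c.Pθ θ := by
    intro Mc jj hMc h θ hθ
    cases hv : c.psiTailLo Mc jj with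
    | none => simp [hv] at h
    | some v =>
      simp only [hv, decide_eq_true_eq] at h
      have hψ := psiTailLo_sound hS hpi hrho hρ hMc jj hv hθ
      have hCr : ((c.constI.lo : ℤ) : ℝ) / c.S ≤ c.constR := lo_le hS hC
      have hsplit : sumVal c.termsR θ = sumVal (cList c.terms c.termsR) θ + sumVal (ncList c.terms c.termsR) θ := by
        rw [sumVal_cList c.terms c.termsR hF θ]; ring
      have hz : (0 : ℝ) ≤ ((v + c.constI.lo - c.bInc + c.mT : ℤ) : ℝ) / c.S := by
        have : (0 : ℝ) ≤ ((v + c.constI.lo - c.bInc + c.mT : ℤ) : ℝ) := by exact_mod_cast h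
        positivity
      unfold Pθ; rw [hsplit]
      push_cast at hz
      have := hT θ; have := hnc θ
      rw [add_div, sub_div, add_div] at hz
      linarith
  -- (3) every θ
  have hall : ∀ θ : ℝ, 0 ≤ c.Pθ θ := by
    -- first for θ ≥ bStart b0
    have hge : ∀ θ : ℝ, bStart b0 ≤ θ → 0 ≤ c.Pθ θ := by
      intro θ hθ
      rcases le_total θ (bEnd bl) with hle | hgt
      · exact Pθ_nonneg_of_covered hS hpi hrho hρ hC hR hF hblocks hcells h0 hl hθ hle
      · refine tail_of bl.Mc (bl.j0 + bl.n) (hbs bl hbl).1 htl θ ?_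
        have hjj : (0 : ℝ) ≤ ((bl.j0 + bl.n : ℤ) : ℝ) := by
          have : 0 < bEnd bl := lt_of_lt_of_le Real.pi_pos hend
          unfold bEnd at this
          have := (div_pos_iff_of_pos_right hMcl).1 this
          push_cast; nlinarith [Real.pi_pos]
        rw [abs_of_nonneg hjj]
        have : bEnd bl = 2 * π * ((bl.j0 + bl.n : ℤ) : ℝ) / bl.Mc := by unfold bEnd; push_cast; ring
        rw [← this]
        exact hgt.trans (le_abs_self θ)
    intro θ
    rcases le_total (bStart b0) θ with hθ | hθ
    · exact hge θ hθ
    · by_cases he : c.even = true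
      · rw [← Pθ_neg hvals he θ]
        exact hge (-θ) (by linarith)
      · rw [Bool.not_eq_true] at he
        simp only [he, Bool.false_eq_true, false_or] at htf
        refine tail_of b0.Mc b0.j0 (hbs b0 hb0).1 htf θ ?_
        simp only [he, Bool.false_eq_true, if_false] at hfirst
        have hj0 : (b0.j0 : ℝ) ≤ 0 := by
          have : (2 * b0.j0 : ℝ) ≤ -(b0.Mc : ℝ) := by exact_mod_cast hfirst
          linarith
        rw [abs_of_nonpos hj0]
        have hθ0 : θ ≤ 0 := hθ.trans hstart0
        rw [abs_of_nonpos hθ0]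
        unfold bStart at hθ
        have : 2 * π * -(b0.j0 : ℝ) / b0.Mc = -(2 * π * b0.j0 / b0.Mc) := by ring
        rw [this]; linarith
  -- (4) translate to the Weil weight
  have hmain := hall (c.omegaR * τ)
  unfold Pθ at hmain
  have hval := sumVal_valsR_eq (χ := χ) hp0 hD hvals (by
    unfold valsNodup at hnodup; simpa using hnodup) hχ τ
  unfold termsR at hmain
  rw [sumVal_append, sumVal_atoms, hval] at hmain
  unfold weilFinitePrimeWeightChar
  have harg : (c.sigR : ℂ) + ((c.rhoR * (c.omegaR * τ) : ℝ) : ℂ) * I =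
      1 / 4 + (charParity χ : ℂ) / 2 + (τ : ℂ) / 2 * I := by
    rw [← mul_assoc, hρω, hpar]
    unfold sigR
    push_cast; ring
  rw [harg] at hmain
  unfold constR at hmain
  linarith

/-- **The rung from a passing certificate.**  If `c.check = true` and `c.q ≠ 1`, then for every
Dirichlet character `χ` mod `c.q` with `charParity χ = c.par` and the claimed window values
`χ(n) = e^{2πi u/v}`: `WeilPositivityOnChar χ (log (c.N + 1) / 2)` — Weil positivity of `L(s, χ)` for
all smooth test functions supported in `[−log(N+1)/2, log(N+1)/2]`. [folklore] -/
theorem weilPositivityOnChar_of_check (hc : c.check = true) (hq : c.q ≠ 1) (χ : DirichletCharacter ℂ c.q)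
    (hpar : charParity χ = c.par) (hχ : ∀ val ∈ c.vals, χ (val.n : ZMod c.q) = valZ val) :
    WeilPositivityOnChar χ (Real.log ((c.N : ℝ) + 1) / 2) := by
  refine weilPositivityOnChar_of_trigDual hq χ c.N (c.atoms.map c.atomT) ?_ (sound hc χ hpar hχ)
  -- admissibility of the atoms from `atomsOK`
  have hc' := hc
  unfold check frameOK at hc'
  simp only [Bool.and_eq_true] at hc'
  obtain ⟨⟨⟨⟨⟨⟨hconsts, _⟩, _⟩, _⟩, hatoms⟩, _⟩, _⟩ := hc'
  obtain ⟨_, hp0, hD, -⟩ := constsOK_sound hconsts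
  intro A hA
  rw [List.mem_map] at hA
  obtain ⟨atm, hatm, rfl⟩ := hA
  unfold atomsOK at hatoms
  rw [List.all_eq_true] at hatoms
  have h := hatoms atm hatm
  rw [decide_eq_true_eq] at h
  simp only [atomT, omegaR]
  have hp0r : (1 : ℝ) < c.p0 := by exact_mod_cast hp0
  have hDr : (0 : ℝ) < c.D := by exact_mod_cast hD
  have hN1 : (0 : ℝ) < (c.N : ℝ) + 1 := by positivity
  have hreal : ((c.N : ℝ) + 1) ^ c.D ≤ (c.p0 : ℝ) ^ atm.k := by exact_mod_cast h
  have hlogle := Real.log_le_log (by positivity) hreal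
  rw [Real.log_pow, Real.log_pow] at hlogle
  rw [← mul_div_assoc, le_div_iff₀ hDr]
  linarith

/-! ### Window values that occur in instances: `1`, `−1`, `±i` -/

/-- `valZ = 1` for the claimed angle `0/1`. [folklore] -/
theorem valZ_zero (n p e slo shi sden : ℕ) : valZ ⟨n, p, e, 0, 1, slo, shi, sden⟩ = 1 := by
  simp [valZ]

/-- `valZ = −1` for the claimed angle `1/2`. [folklore] -/
theorem valZ_half (n p e slo shi sden : ℕ) : valZ ⟨n, p, e, 1, 2, slo, shi, sden⟩ = -1 := by
  unfold valZ
  have h : (2 : ℂ) * (Real.pi : ℂ) * (((((1 : ℤ) : ℝ) / ((2 : ℕ) : ℝ) : ℝ)) : ℂ) * Complex.I =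
      (Real.pi : ℂ) * Complex.I := by push_cast; ring
  rw [h, Complex.exp_pi_mul_I]

/-- `valZ = i` for the claimed angle `1/4`. [folklore] -/
theorem valZ_quarter (n p e slo shi sden : ℕ) : valZ ⟨n, p, e, 1, 4, slo, shi, sden⟩ = Complex.I := by
  unfold valZ
  have h : (2 : ℂ) * (Real.pi : ℂ) * (((((1 : ℤ) : ℝ) / ((4 : ℕ) : ℝ) : ℝ)) : ℂ) * Complex.I =
      ((Real.pi / 2 : ℝ) : ℂ) * Complex.I := by push_cast; ring
  rw [h, Complex.exp_mul_I, ← Complex.ofReal_cos, ← Complex.ofReal_sin, Real.cos_pi_div_two,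
    Real.sin_pi_div_two]
  simp

/-- `valZ = −i` for the claimed angle `−1/4`. [folklore] -/
theorem valZ_negQuarter (n p e slo shi sden : ℕ) :
    valZ ⟨n, p, e, -1, 4, slo, shi, sden⟩ = -Complex.I := by
  unfold valZ
  have h : (2 : ℂ) * (Real.pi : ℂ) * (((((-1 : ℤ) : ℝ) / ((4 : ℕ) : ℝ) : ℝ)) : ℂ) * Complex.I =
      ((-(Real.pi / 2) : ℝ) : ℂ) * Complex.I := by push_cast; ring
  rw [h, Complex.exp_mul_I, ← Complex.ofReal_cos, ← Complex.ofReal_sin, Real.cos_neg, Real.sin_neg,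
    Real.cos_pi_div_two, Real.sin_pi_div_two]
  simp

end DKCert

end Summit.Ventures.WeilGRH
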